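import Summits.Schanuel.Schanuel.Theses.RigidCore
import Literature.NumberTheory.Transcendental.ExpPointsExamples

/-!
# Non-real jet or tail: finitely many integer points (stub `stub_nonRealJetFinite`)

Stub (Im) of the line `cusp-germ-schneider-sparsity` for the crux `RigidCore.SparsityTwo`
(item stmt-Schanuel-0971). On a normalised log-free cusp ray the hits are the `N : ℕ` at which the
germ `h N = A (w N) + g ((w N)⁻¹)`, `w N = N ^ (1/e) ∈ ℝ`, takes an INTEGER value; here `A ∈ ℂ[w]` is
the polar jet and `g` (analytic at `0`, `g 0 = 0`) is the tail. If the jet has a non-real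
coefficient, or the tail is not real on the positive real axis near `0`, then there are only
finitely many such `N`, because integers are real:

* for real `x`, `Im A(x) = B(x)` with `B = Σ_k Im(a_k) X^k ∈ ℝ[X]`;
* if `B ≠ 0`, then `|B (w N)|` is eventually bounded below by a positive constant (it tends to
  `∞` if `deg B > 0`, and is the non-zero constant `|Im a₀|` otherwise) while `Im g((w N)⁻¹) → 0`
  (`(w N)⁻¹ → 0`, continuity of `g`, `g 0 = 0`), so `Im h N ≠ 0` for all large `N`;
* if `B = 0` but `t ↦ Im g(t)` (real-analytic at `0`) is not eventually zero on `(0, δ)`, then by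
  the principle of isolated zeros it is eventually NON-zero on a punctured neighbourhood of `0`,
  and `(w N)⁻¹ → 0⁺` gives again `Im h N ≠ 0` for all large `N`.

The only property of the ray parameter used is `w N → +∞`, so the asymptotic lemma is proved for
an arbitrary real sequence tending to `+∞` and then specialised to `w N = N ^ (1/e)`.

Sources: elementary; Mathlib only (`AnalyticAt.im_ofReal`,
`AnalyticAt.eventually_eq_zero_or_eventually_ne_zero`, `Polynomial.abs_tendsto_atTop`,
`tendsto_rpow_atTop`, `Nat.cofinite_eq_atTop`).
-/

namespace Summit.Schanuel.Schanuel.Cruxes.SparsityTwo.CuspGermSchneiderSparsity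

open Filter Topology Complex Polynomial Literature.NumberTheory.Transcendental
open scoped Real

/-- The imaginary part of a complex polynomial along the real axis is a real polynomial: there is
`B ∈ ℝ[X]` with coefficients `Im (a_k)` such that `Im (A x) = B x` for every real `x`. -/
private theorem exists_imPoly (A : Polynomial ℂ) :
    ∃ B : Polynomial ℝ, (∀ k, B.coeff k = (A.coeff k).im) ∧
      ∀ x : ℝ, (A.eval (x : ℂ)).im = B.eval x := by
  refine ⟨∑ k ∈ Finset.range (A.natDegree + 1), C (A.coeff k).im * X ^ k, ?_, ?_⟩
  · intro k
    simp only [finsetSum_coeff, coeff_C_mul_X_pow]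
    rw [Finset.sum_ite_eq]
    split_ifs with h
    · rfl
    · rw [Finset.mem_range, not_lt] at h
      rw [coeff_eq_zero_of_natDegree_lt (by omega), Complex.zero_im]
  · intro x
    rw [eval_eq_sum_range, eval_finsetSum, Complex.im_sum]
    refine Finset.sum_congr rfl fun k _ => ?_
    rw [← Complex.ofReal_pow, Complex.im_mul_ofReal, eval_mul, eval_C, eval_pow, eval_X]

/-- The asymptotic core. Let `w N → +∞` be a real sequence, `A ∈ ℂ[X]`, `g` analytic at `0` with
`g 0 = 0`, and assume that NOT (all coefficients of `A` are real and `Im g` vanishes on `(0, δ)`).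
Then `Im (A (w N) + g ((w N)⁻¹)) ≠ 0` for all large `N`. -/
private theorem eventually_im_ne_zero (w : ℕ → ℝ) (hw : Tendsto w atTop atTop)
    (A : Polynomial ℂ) (g : ℂ → ℂ) (hg : AnalyticAt ℂ g 0) (hg0 : g 0 = 0)
    (hnot : ¬ ((∀ k : ℕ, (A.coeff k).im = 0) ∧ ∀ᶠ t : ℝ in 𝓝[>] 0, (g (t : ℂ)).im = 0)) :
    ∀ᶠ N in atTop, (A.eval ((w N : ℝ) : ℂ) + g (((w N : ℝ) : ℂ))⁻¹).im ≠ 0 := by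
  -- the inverse ray parameter tends to `0⁺`
  have ht : Tendsto (fun N => (w N)⁻¹) atTop (𝓝[>] (0 : ℝ)) :=
    tendsto_inv_atTop_nhdsGT_zero.comp hw
  have ht0 : Tendsto (fun N => (w N)⁻¹) atTop (𝓝 (0 : ℝ)) := ht.mono_right nhdsWithin_le_nhds
  -- `Im g ((w N)⁻¹) → 0`
  have hgim : Tendsto (fun N => (g (((w N)⁻¹ : ℝ) : ℂ)).im) atTop (𝓝 0) := by
    have h1 : Tendsto (fun N => (((w N)⁻¹ : ℝ) : ℂ)) atTop (𝓝 ((0 : ℝ) : ℂ)) :=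
      (Complex.continuous_ofReal.tendsto 0).comp ht0
    rw [Complex.ofReal_zero] at h1
    have h2 : Tendsto (fun N => g (((w N)⁻¹ : ℝ) : ℂ)) atTop (𝓝 (g 0)) :=
      hg.continuousAt.tendsto.comp h1
    rw [hg0] at h2
    have h3 : Tendsto (fun N => (g (((w N)⁻¹ : ℝ) : ℂ)).im) atTop (𝓝 (0 : ℂ).im) :=
      (Complex.continuous_im.tendsto 0).comp h2
    rwa [Complex.zero_im] at h3
  obtain ⟨B, hBcoeff, hBeval⟩ := exists_imPoly A
  -- the imaginary part of the germ value along the ray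
  have him : ∀ N, (A.eval ((w N : ℝ) : ℂ) + g (((w N : ℝ) : ℂ))⁻¹).im
      = B.eval (w N) + (g (((w N)⁻¹ : ℝ) : ℂ)).im := by
    intro N
    rw [Complex.add_im, hBeval, ← Complex.ofReal_inv]
  -- KEY: eventually this imaginary part is non-zero
  have hkey : ∀ᶠ N in atTop, B.eval (w N) + (g (((w N)⁻¹ : ℝ) : ℂ)).im ≠ 0 := by
    by_cases hA : ∀ k : ℕ, (A.coeff k).im = 0
    · -- real jet, tail not real on the ray: isolated zeros of the real-analytic `t ↦ Im g(t)`
      have hB0 : B = 0 := Polynomial.ext fun k => by rw [hBcoeff, hA, coeff_zero]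
      have hng : ¬ ∀ᶠ t : ℝ in 𝓝[>] 0, (g (t : ℂ)).im = 0 := fun h => hnot ⟨hA, h⟩
      have hg' : AnalyticAt ℂ g ((0 : ℝ) : ℂ) := by rwa [Complex.ofReal_zero]
      have hf : AnalyticAt ℝ (fun t : ℝ => (g (t : ℂ)).im) 0 := hg'.im_ofReal
      rcases hf.eventually_eq_zero_or_eventually_ne_zero with h0 | hne
      · exact absurd (h0.filter_mono nhdsWithin_le_nhds) hng
      · have hne' : ∀ᶠ t : ℝ in 𝓝[>] 0, (g (t : ℂ)).im ≠ 0 :=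
          hne.filter_mono (nhdsGT_le_nhdsNE 0)
        filter_upwards [ht.eventually hne'] with N hN
        simpa [hB0] using hN
    · -- non-real jet: `|B (w N)|` is eventually bounded below, `Im g ((w N)⁻¹) → 0`
      push Not at hA
      obtain ⟨k, hk⟩ := hA
      have hB : B ≠ 0 := fun h => hk (by rw [← hBcoeff, h, coeff_zero])
      obtain ⟨c, hc, hcB⟩ : ∃ c : ℝ, 0 < c ∧ ∀ᶠ N in atTop, c ≤ |B.eval (w N)| := by
        by_cases hdeg : 0 < B.degree
        · exact ⟨1, one_pos, ((B.abs_tendsto_atTop hdeg).comp hw).eventually_ge_atTop 1⟩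
        · have hB' : B = C (B.coeff 0) := eq_C_of_degree_le_zero (not_lt.mp hdeg)
          have hb : B.coeff 0 ≠ 0 := fun h => hB (by rw [hB', h, C_0])
          refine ⟨|B.coeff 0|, abs_pos.mpr hb, Eventually.of_forall fun N => ?_⟩
          rw [hB', eval_C, coeff_C_zero]
      have hsmall : ∀ᶠ N in atTop, |(g (((w N)⁻¹ : ℝ) : ℂ)).im| < c := by
        filter_upwards [Metric.tendsto_nhds.mp hgim c hc] with N hN
        rwa [Real.dist_0_eq_abs] at hN
      filter_upwards [hcB, hsmall] with N h1 h2
      intro h0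
      have h3 : B.eval (w N) = -(g (((w N)⁻¹ : ℝ) : ℂ)).im := by linarith
      rw [h3, abs_neg] at h1
      exact (lt_irrefl c) (h1.trans_lt h2)
  filter_upwards [hkey] with N hN
  rwa [him]

/-- **stub_nonRealJetFinite** (Im). If the polar jet `A` has a non-real coefficient, or the tail
`g` is not real on the positive real axis near `0`, then `A (N ^ (1/e)) + g (N ^ (-1/e)) ∈ ℤ` for
only finitely many `N : ℕ` (integers are real, and the imaginary part of the germ value is
eventually non-zero along the ray by `eventually_im_ne_zero`). -/
theorem stub_nonRealJetFinite :
    ∀ (e : ℕ), 0 < e → ∀ (A : Polynomial ℂ) (g : ℂ → ℂ), AnalyticAt ℂ g 0 → g 0 = 0 →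
      ¬ ((∀ k : ℕ, (A.coeff k).im = 0) ∧ ∀ᶠ t : ℝ in 𝓝[>] 0, (g (t : ℂ)).im = 0) →
      Set.Finite {N : ℕ | ∃ L : ℤ,
        A.eval ((((N : ℝ) ^ ((e : ℝ)⁻¹) : ℝ) : ℂ)) + g ((((N : ℝ) ^ ((e : ℝ)⁻¹) : ℝ) : ℂ))⁻¹ = L} := by
  intro e he A g hg hg0 hnot
  have hw : Tendsto (fun N : ℕ => (N : ℝ) ^ ((e : ℝ)⁻¹)) atTop atTop :=
    (tendsto_rpow_atTop (inv_pos.mpr (Nat.cast_pos.mpr he))).comp tendsto_natCast_atTop_atTop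
  have hev : ∀ᶠ N : ℕ in atTop, (A.eval ((((N : ℝ) ^ ((e : ℝ)⁻¹) : ℝ) : ℂ)) +
      g ((((N : ℝ) ^ ((e : ℝ)⁻¹) : ℝ) : ℂ))⁻¹).im ≠ 0 :=
    eventually_im_ne_zero (fun N : ℕ => (N : ℝ) ^ ((e : ℝ)⁻¹)) hw A g hg hg0 hnot
  have hev' : ∀ᶠ N : ℕ in atTop, ¬ ∃ L : ℤ, A.eval ((((N : ℝ) ^ ((e : ℝ)⁻¹) : ℝ) : ℂ)) +
      g ((((N : ℝ) ^ ((e : ℝ)⁻¹) : ℝ) : ℂ))⁻¹ = L := by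
    filter_upwards [hev] with N hN
    rintro ⟨L, hL⟩
    rw [hL, Complex.intCast_im] at hN
    exact hN rfl
  rw [← Nat.cofinite_eq_atTop, Filter.eventually_cofinite] at hev'
  exact hev'.subset fun N hN => not_not.mpr hN

end Summit.Schanuel.Schanuel.Cruxes.SparsityTwo.CuspGermSchneiderSparsity
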